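import Literature.MathematicalPhysics.QuantumFieldTheory.Balaban1983to89.Node00.MultiScaleFibreChart
import Literature.MathematicalPhysics.QuantumFieldTheory.Balaban1983to89.B16Ineq17NearFlatOneSidedSeminorm
import Literature.MathematicalPhysics.QuantumFieldTheory.Balaban1983to89.B15Prop1ClassOpenAtRecord
import Literature.MathematicalPhysics.QuantumFieldTheory.Balaban1983to89.B14Eq213DetSet

/-!
# NODE 00 — THE LAGRANGE FORM `D(A∘expChart U₀)(0) = λ₀ ∘ DΨ(0)` AT THE CANONICAL CHART OF THE MULTI-SCALE CONSTRAINT, FROM CURVE-CRITICALITY ON THE FIBRE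
# AND ONTO-NESS OF THE LINEARISED CONSTRAINT; THE CHART's REGULARITY BINDERS (`C²` AT `0`)

[Balaban1985Variational] = «[15]», (82)–(83) p. 290 (tangent form of criticality), Sect. C (44)–(48) p. 285 (the linearised averaging is onto, right inverses `H`),
(170)–(171) p. 305; [Balaban1989LargeFieldII] = «[LF-II]», (1.12) p. 359 (the expansion at the background `U₀ = exp(iA₀)` with the multiplier absorbed), p. 357;
[Balaban1988Convergent] = «[III]», (2.10)–(2.12) p. 256 (the multi-scale constraint and its minimal configurations).

Cell `pub-ymgap`, HUMAN RULING D-0062 ∕ D-0149, width seat `pub-ymgap-dag-n12-w4` generation 3 (WIDTH SEAT 4 of 4 on N12 = [B15]; lane U2c «assembler of the (L2) display route at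
the record»; INBOX CLAIM-1 ∕ INTENT-1 of 2026-08-28).  `--kind proof --supports stmt-QuantumFields-20542` (K1⁷; count-neutral helper).  NEW leaf; CONSUMED BY NAME, nothing
modified: n07-w2's `Node00.MultiScaleFibreChart` (`msChart`, `contDiffAt_msChart`, `hasStrictFDerivAt_msChart`, `eventually_agreeOn_of_msChart_eq`, `isFibreChartNear_msChart`), n07-e's 35a
`Node00.CriticalOnFibreTangent` (`IsFibreChartNear`, `hasDerivAt_wilsonAction4_expChart_of_isCritOnFibre_near`, `hasDerivAt_ray`) and `Node00.CriticalOnFibre` (`IsCritOnFibre`,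
`deriv_wilsonAction4_eq_zero_of_isMinimizer`, `isCritOnFibre_of_isMinimizer_class17`), NODE 00's `regMSCoPOfRecord[At]` (`Node00.LargeFieldBackgroundCoPOfRecord`) and dag-n12-w1's
`B15Prop1ClassOpenAtRecord.eventually_mem_regMSCoPOfRecordAt`, r12's `B14.Eq213DetSet` (`Bj`, `Bj_of_gt`), dag-n12-w3's `B11Eq177CriticalFamilyDerivative` (`contDiff_wilsonAction4_expChart`,
`exists_multiplier_of_surjective`, `multiplier_unique`) and this seat's g2 `B16Ineq17NearFlatOneSidedSeminorm` (`abs_multiplier_apply_le_seminorm`).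

WHY.  The N12∕s1 lane's junction of record `B15Prop1SliceHessianOfChartFamily.h17Shape_sliceFn_of_nearFlatCriticalExpChartFamily` (dag-n12-c p604041 §4 = this seat's near-flat
one-sided (1.7) skeleton `B16Ineq17NearFlatWilsonLetters.hessian_wilsonAction4_criticalExpChartFamily_ge_flatMin_sub` at the slice) carries, at the constraint chart `Ψ`, the binders
  `hlam : fderiv ℝ (fun Y => wilsonAction4 (expChart U₀ Y)) 0 = lam.comp (fderiv ℝ Ψ 0)`   (the Lagrange form of [15] (82)∕(83) ∕ [LF-II] (1.12)),
  `hΨ₂ : HasFDerivAt (fun Y => fderiv ℝ Ψ Y) Ψ₂ 0`,  `hΨd : ∀ᶠ Y in 𝓝 0, DifferentiableAt ℝ Ψ Y`   (the chart is `C²` at `0`),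
and the lane owner's assembled endpoint (J-C) reads them at the CHART OF RECORD `Ψ := msChart F N K k 𝐁 W U₀` (n07-w2).  THIS MODULE discharges all three there from the knit's own
objects: `hlam` from CURVE-CRITICALITY of `U₀` on the multi-scale fibre (`IsCritOnFibre`, the currency of dag-n12-w6's `hcritT`-transfer and of n07-e's «minimal ⇒ critical») plus
ONTO-NESS of `DΨ(0)` (dag-n10-w1's `…N12GuardedLinAvgRightInverse.surjective_fderiv_msChart_of_flat` ∕ `exists_rightInverse_fderiv_msChart_of_flat`, or a flat right inverse + (δ₂)
through this seat's `B16Ineq17NearFlatSubmersion.exists_rightInverse_fun_of_opNorm_sub_lt`), by 35a's implicit-function step «curve-critical ⇒ tangent-critical» and the algebraic Lagrange form of dag-n12-w3; `hΨ₂`∕`hΨd` from n07-w2's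
`contDiffAt_msChart` (`C^∞` at `0` under the fibre condition `hU` and the guard `hsb`).

CONTENTS (namespace `…Balaban1983to89.Node00`; theorems only — no `def`, no `instance`, no `notation`, no `sorry`).
* §1 (any submersive chart `Φ` of the constraint near `U₀`, 35a's `IsFibreChartNear`) ★ `fderiv_wilsonAction4_expChart_apply_eq_zero_of_isCritOnFibre_near` (`Φ′X = 0 ⇒ D(A∘expChart U₀)(0)X = 0`),
  ★★ `exists_lam_of_isFibreChartNear_of_isCritOnFibre` (`∃ λ₀, D(A∘expChart U₀)(0) = λ₀ ∘ Φ′`), `lam_unique_of_isFibreChartNear`.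
* §2 (the chart of record `msChart`) `isFibreChartNear_msChart_of_surjective`, ★ `fderiv_wilsonAction4_expChart_apply_eq_zero_of_isCritOnFibre_of_surjective`,
  ★★★ `exists_lam_msChart_of_surjective` (THE BINDER `hlam` OF THE J-C JUNCTION, verbatim, from `hsurj` + `hcrit`), `lam_msChart_unique`, ★★ `exists_lam_msChart_of_rightInverse`
  (n07-w2's velocity-currency right inverse `hH`), ★★ `exists_lam_msChart_of_rightInverse_fun` (a right inverse of `DΨ(0)` as a function — dag-n10-w1's currency),
  ★★ `exists_lam_msChart_bound_of_rightInverse_fun` (quantitative edition in the junction's seminorm currency: `p(Rv) ≤ ρ·q(v)`, current bound `|D(A∘expChart U₀)(0)x| ≤ j·p(x)` ⇒ `hlam`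
  with `|λ₀ v| ≤ j·ρ·q(v)` — this seat's g2 `abs_multiplier_apply_le_seminorm` with its Lagrange-form hypothesis DISCHARGED by `hcrit`).
* §3 (regularity of the chart of record) `hasFDerivAt_msChart`, `differentiableAt_msChart`, ★ `hasFDerivAt_fderiv_msChart` (the binder `hΨ₂` with `Ψ₂ := D²Ψ(0)`),
  ★ `eventually_differentiableAt_msChart` (the binder `hΨd`), `eventually_contDiffAt_msChart`.
* §4 (from minimality; the record's class and determining set) ★ `isCritOnFibre_of_isMinimizer_of_eventually_mem` (ANY class that is a neighbourhood of the minimiser),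
  ★★ `exists_lam_msChart_of_isMinimizer_of_eventually_mem`, ★★ `exists_lam_msChart_of_isMinimizer_class17` (def-R's (1.7)-class, n07-e's `isCritOnFibre_of_isMinimizer_class17`),
  ★★ `isCritOnFibre_of_isMinimizer_regMSCoPOfRecordAt` ∕ `…_regMSCoPOfRecord` (NODE 00's class of record is a neighbourhood of its members — dag-n12-w1's `eventually_mem_regMSCoPOfRecordAt` — so its
  minimisers are curve-critical: `hcrit` DISCHARGED at the record), ★★★ `exists_lam_msChart_Bj_of_isMinimizer_regMSCoPOfRecord` (the J-C binder `hlam` at the endpoint's objects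
  `regMSCoPOfRecord F N ν K k′ Ω`, `Bj M₁ Z k`, from minimality + guard + onto-ness), `exists_lam_msChart_Bj_of_surjective`.

HONEST FRAMING: finite-dimensional calculus on the tree's own chart (Fermat along curves, the implicit-function step of 35a, the algebraic Lagrange form, `C^∞ ⇒ C²`); nothing of
Bałaban's is asserted; the onto-ness of `DΨ(0)` ([15] (45)) and curve-criticality stay DISPLAYED HYPOTHESES here (producers named above); the multiplier's SIZE letter (μ) = `j·ρ·M₂`
is this seat's g2 `B16Ineq17NearFlatOneSided.multiplier_letter_of_current` with `M₂` still displayed; N12 NOT discharged; K1⁷ NOT closed; counts unmoved (5∕27); one finite 𝕋⁴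
programme at fixed ε — R4 closes the conditional rung `BalabanLadder.UV` only; NOT continuum ∕ ℝ⁴ ∕ OS ∕ mass gap ∕ Clay.
-/

noncomputable section

namespace Literature.MathematicalPhysics.QuantumFieldTheory.Balaban1983to89.Node00

open Filter Topology
open T4Continuum (T4Family)
open B15DeterminingSets
open T4AdjointCovarianceUnitary (lieSU)
open B11Eq177CriticalFamilyDerivative (contDiff_wilsonAction4_expChart exists_multiplier_of_surjective multiplier_unique)
open B16Ineq17NearFlatOneSidedSeminorm (abs_multiplier_apply_le_seminorm)
open B15Prop1ClassOpenAtRecord (eventually_mem_regMSCoPOfRecordAt)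
open B14.Eq213DetSet (Bj Bj_of_gt)
open scoped Matrix.Norms.L2Operator

variable {F : T4Family} {N : ℕ} [NeZero N]
variable {K k : ℕ} {𝔹 : DetSet (F.P K)} {W : MSField (F.P K) (SU N)} {U : GaugeField (F.P K) 0 (SU N)}

/-! ## §1  Any submersive chart of the constraint: tangent-criticality in Fréchet form, and the Lagrange form -/

section Abstract

variable {V : Type*} [NormedAddCommGroup V] [NormedSpace ℝ V] [FiniteDimensional ℝ V]
  {Φ : (PBond (F.P K) 0 → lieSU (Fin N)) → V} {Φ' : (PBond (F.P K) 0 → lieSU (Fin N)) →L[ℝ] V}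

/-- ★ **CURVE-CRITICAL ⇒ THE FIRST VARIATION KILLS `ker Φ′` (Fréchet form of (82)∕(83))**: for a submersive chart `Φ` of the constraint near `U₀` (35a `IsFibreChartNear`) and
`U₀` curve-critical on the fibre, `D(A∘expChart U₀)(0)X = 0` for every `X` with `Φ′X = 0` — 35a's ray statement `d∕dt A(U₀·e^{tX})∣₀ = 0` read through the Fréchet derivative
of the `C^ω` map `A∘expChart U₀` (dag-n12-w3's `contDiff_wilsonAction4_expChart`). [cite: Balaban1985Variational, (82)–(83) p.290, (141) p.299, p.300; Balaban1989LargeFieldII, (1.12) p.359] -/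
theorem fderiv_wilsonAction4_expChart_apply_eq_zero_of_isCritOnFibre_near
    (hΦ : IsFibreChartNear F N K 𝔹 W U Φ Φ') (hcrit : IsCritOnFibre F N K 𝔹 W U)
    {X : PBond (F.P K) 0 → lieSU (Fin N)} (hX : Φ' X = 0) :
    fderiv ℝ (fun Y : PBond (F.P K) 0 → lieSU (Fin N) => wilsonAction4 (expChart U Y)) 0 X = 0 := by
  have hd : DifferentiableAt ℝ (fun Y : PBond (F.P K) 0 → lieSU (Fin N) => wilsonAction4 (expChart U Y)) 0 :=
    ((contDiff_wilsonAction4_expChart U).differentiable (by simp)).differentiableAt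
  have hray : HasDerivAt (fun t : ℝ => wilsonAction4 (expChart U (t • X)))
      (fderiv ℝ (fun Y : PBond (F.P K) 0 → lieSU (Fin N) => wilsonAction4 (expChart U Y)) 0 X) 0 :=
    hd.hasFDerivAt.comp_hasDerivAt_of_eq (0 : ℝ) (hasDerivAt_ray X) (zero_smul ℝ X).symm
  exact hray.unique (hasDerivAt_wilsonAction4_expChart_of_isCritOnFibre_near hΦ hcrit hX)

/-- ★★ **THE LAGRANGE FORM AT A CURVE-CRITICAL CONFIGURATION, ANY SUBMERSIVE CHART**: `D(A∘expChart U₀)(0) = λ₀ ∘ Φ′` for some continuous linear `λ₀ : V → ℝ` — the first variation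
kills `ker Φ′` (above) and `Φ′` is ONTO (the chart hypothesis), so it factors (dag-n12-w3's `exists_multiplier_of_surjective`).  This is the binder `hlam` of the near-flat one-sided
(1.7) skeleton (`B16Ineq17NearFlatWilsonLetters`, `B15Prop1SliceHessianOfChartFamily` §4) at `Ψ := Φ`. [cite: Balaban1985Variational, (82)–(83) p.290, (170)–(171) p.305; Balaban1989LargeFieldII, (1.12) p.359, p.357] -/
theorem exists_lam_of_isFibreChartNear_of_isCritOnFibre
    (hΦ : IsFibreChartNear F N K 𝔹 W U Φ Φ') (hcrit : IsCritOnFibre F N K 𝔹 W U) :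
    ∃ lam : V →L[ℝ] ℝ, fderiv ℝ (fun Y : PBond (F.P K) 0 → lieSU (Fin N) => wilsonAction4 (expChart U Y)) 0 = lam.comp Φ' := by
  have hsurj : Function.Surjective Φ' := by
    have h := LinearMap.range_eq_top.1 hΦ.2.1
    exact h
  exact exists_multiplier_of_surjective _ Φ' hsurj
    (fun X hX => fderiv_wilsonAction4_expChart_apply_eq_zero_of_isCritOnFibre_near hΦ hcrit hX)

/-- The multiplier of a submersive chart is unique (`Φ′` onto). [cite: Balaban1985Variational, (82)–(83) p.290 (bookkeeping)] -/
theorem lam_unique_of_isFibreChartNear (hΦ : IsFibreChartNear F N K 𝔹 W U Φ Φ') {lam lam' : V →L[ℝ] ℝ}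
    (h : fderiv ℝ (fun Y : PBond (F.P K) 0 → lieSU (Fin N) => wilsonAction4 (expChart U Y)) 0 = lam.comp Φ')
    (h' : fderiv ℝ (fun Y : PBond (F.P K) 0 → lieSU (Fin N) => wilsonAction4 (expChart U Y)) 0 = lam'.comp Φ') : lam = lam' := by
  have hsurj : Function.Surjective Φ' := by
    have hr := LinearMap.range_eq_top.1 hΦ.2.1
    exact hr
  exact multiplier_unique hsurj h h'

end Abstract

/-! ## §2  The chart of record `Ψ := msChart F N K k 𝐁 W U₀`: the binder `hlam` from onto-ness of `DΨ(0)` and curve-criticality -/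

section Record

/-- **35a's `IsFibreChartNear` FOR THE CHART OF RECORD, FROM ONTO-NESS OF `DΨ(0)` STATED DIRECTLY** (the currency dag-n10-w1's `surjective_fderiv_msChart_of_flat` delivers, and the one this
seat's `B16Ineq17NearFlatSubmersion.surjective_of_opNorm_sub_lt` produces from a flat right inverse + (δ₂)): strict differentiability and the level-set clause are n07-w2's
`hasStrictFDerivAt_msChart` ∕ `eventually_agreeOn_of_msChart_eq`. [cite: Balaban1985Variational, Sect. C (44)–(48) p.285, (82)–(83) p.290; Balaban1988Convergent, (2.10)–(2.12) p.256] -/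
theorem isFibreChartNear_msChart_of_surjective (h𝔹 : ∀ j, k < j → 𝔹 j = ∅) (hU : AgreeOn 𝔹 (avgFamily (avOfRecord F N K) U) W)
    (hsb : SmallBelow (avOfRecord F N K) k U) (hsurj : Function.Surjective (fderiv ℝ (msChart F N K k 𝔹 W U) 0)) :
    IsFibreChartNear F N K 𝔹 W U (msChart F N K k 𝔹 W U) (fderiv ℝ (msChart F N K k 𝔹 W U) 0) :=
  ⟨hasStrictFDerivAt_msChart hU hsb, LinearMap.range_eq_top.2 hsurj, eventually_agreeOn_of_msChart_eq h𝔹 hU hsb⟩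

/-- ★ **AT THE CHART OF RECORD, THE FIRST VARIATION KILLS `ker DΨ(0)`** (`hφ` of this seat's `B16Ineq17NearFlatSubmersion.exists_multiplier_of_opNorm_sub_lt`, DISCHARGED): for `𝐁` with no
member above `k`, `U₀` in the fibre with guarded averages, `DΨ(0)` onto and `U₀` curve-critical on the fibre, `DΨ(0)X = 0 ⇒ D(A∘expChart U₀)(0)X = 0`.
[cite: Balaban1985Variational, (82)–(83) p.290, p.300; Balaban1989LargeFieldII, (1.12) p.359] -/
theorem fderiv_wilsonAction4_expChart_apply_eq_zero_of_isCritOnFibre_of_surjective (h𝔹 : ∀ j, k < j → 𝔹 j = ∅)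
    (hU : AgreeOn 𝔹 (avgFamily (avOfRecord F N K) U) W) (hsb : SmallBelow (avOfRecord F N K) k U)
    (hsurj : Function.Surjective (fderiv ℝ (msChart F N K k 𝔹 W U) 0)) (hcrit : IsCritOnFibre F N K 𝔹 W U)
    {X : PBond (F.P K) 0 → lieSU (Fin N)} (hX : fderiv ℝ (msChart F N K k 𝔹 W U) 0 X = 0) :
    fderiv ℝ (fun Y : PBond (F.P K) 0 → lieSU (Fin N) => wilsonAction4 (expChart U Y)) 0 X = 0 :=
  fderiv_wilsonAction4_expChart_apply_eq_zero_of_isCritOnFibre_near (isFibreChartNear_msChart_of_surjective h𝔹 hU hsb hsurj) hcrit hX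

/-- ★★★ **THE BINDER `hlam` OF THE J-C JUNCTION AT THE CHART OF RECORD** (`B15Prop1SliceHessianOfChartFamily.h17Shape_sliceFn_of_nearFlatCriticalExpChartFamily`, `Ψ := msChart F N K k 𝐁 W U₀`):
for a determining set with no member above `k`, a configuration `U₀` in the fibre `𝔅(𝐁, W)` whose iterated averages are guarded (`SmallBelow`), with `DΨ(0)` ONTO ([15] (45) at `U₀` —
dag-n10-w1's `surjective_fderiv_msChart_of_flat` at guarded near-flat backgrounds) and `U₀` a CRITICAL CONFIGURATION OF (5) ON THE FIBRE in the curve form (`IsCritOnFibre` — n07-e's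
«minimal ⇒ critical», dag-n12-w6's `hcritT`-transfer): `D(A∘expChart U₀)(0) = λ₀ ∘ DΨ(0)` for some continuous linear `λ₀`.
[cite: Balaban1985Variational, (82)–(83) p.290, (170)–(171) p.305, Sect. C (45)–(48) p.285; Balaban1989LargeFieldII, (1.12) p.359, p.357; Balaban1988Convergent, (2.10)–(2.12) p.256] -/
theorem exists_lam_msChart_of_surjective (h𝔹 : ∀ j, k < j → 𝔹 j = ∅)
    (hU : AgreeOn 𝔹 (avgFamily (avOfRecord F N K) U) W) (hsb : SmallBelow (avOfRecord F N K) k U)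
    (hsurj : Function.Surjective (fderiv ℝ (msChart F N K k 𝔹 W U) 0)) (hcrit : IsCritOnFibre F N K 𝔹 W U) :
    ∃ lam : (Fin (constrCard 𝔹 k) → lieSU (Fin N)) →L[ℝ] ℝ,
      fderiv ℝ (fun Y : PBond (F.P K) 0 → lieSU (Fin N) => wilsonAction4 (expChart U Y)) 0 = lam.comp (fderiv ℝ (msChart F N K k 𝔹 W U) 0) :=
  exists_lam_of_isFibreChartNear_of_isCritOnFibre (isFibreChartNear_msChart_of_surjective h𝔹 hU hsb hsurj) hcrit

/-- The multiplier at the chart of record is unique once `DΨ(0)` is onto. [cite: Balaban1985Variational, (82)–(83) p.290 (bookkeeping)] -/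
theorem lam_msChart_unique (hsurj : Function.Surjective (fderiv ℝ (msChart F N K k 𝔹 W U) 0))
    {lam lam' : (Fin (constrCard 𝔹 k) → lieSU (Fin N)) →L[ℝ] ℝ}
    (h : fderiv ℝ (fun Y : PBond (F.P K) 0 → lieSU (Fin N) => wilsonAction4 (expChart U Y)) 0 = lam.comp (fderiv ℝ (msChart F N K k 𝔹 W U) 0))
    (h' : fderiv ℝ (fun Y : PBond (F.P K) 0 → lieSU (Fin N) => wilsonAction4 (expChart U Y)) 0 = lam'.comp (fderiv ℝ (msChart F N K k 𝔹 W U) 0)) :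
    lam = lam' :=
  multiplier_unique hsurj h h'

/-- ★★ **`hlam` FROM A RIGHT INVERSE OF THE LINEARISED CONSTRAINT IN VELOCITY CURRENCY** (n07-w2's `hH`: every family of tangent targets `W_j(c)·τ_j(c)` on the constrained bonds of
levels `≤ k` is the velocity family of `t ↦ Ū^j(U₀·e^{tX})(c)` for some `X` — [15] (45) at `U₀`, existence only): n07-w2's `isFibreChartNear_msChart` + §1.
[cite: Balaban1985Variational, Sect. C (45)–(48) p.285, (82)–(83) p.290, (170)–(171) p.305; Balaban1988Convergent, (2.10)–(2.12) p.256] -/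
theorem exists_lam_msChart_of_rightInverse (h𝔹 : ∀ j, k < j → 𝔹 j = ∅)
    (hU : AgreeOn 𝔹 (avgFamily (avOfRecord F N K) U) W) (hsb : SmallBelow (avOfRecord F N K) k U)
    (hH : ∀ τ : (j : ℕ) → PBond (F.P K) j → lieSU (Fin N), ∃ X : PBond (F.P K) 0 → lieSU (Fin N), ∀ j, j ≤ k → ∀ c ∈ bondsOf (𝔹 j),
      HasDerivAt (fun t : ℝ => ((avgFamily (avOfRecord F N K) (expChart U (t • X)) j c : SU N) : Matrix (Fin N) (Fin N) ℂ))
        (((W j c : SU N) : Matrix (Fin N) (Fin N) ℂ) * ((τ j c : lieSU (Fin N)) : Matrix (Fin N) (Fin N) ℂ)) 0)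
    (hcrit : IsCritOnFibre F N K 𝔹 W U) :
    ∃ lam : (Fin (constrCard 𝔹 k) → lieSU (Fin N)) →L[ℝ] ℝ,
      fderiv ℝ (fun Y : PBond (F.P K) 0 → lieSU (Fin N) => wilsonAction4 (expChart U Y)) 0 = lam.comp (fderiv ℝ (msChart F N K k 𝔹 W U) 0) :=
  exists_lam_of_isFibreChartNear_of_isCritOnFibre (isFibreChartNear_msChart h𝔹 hU hsb hH) hcrit

/-- ★★ **`hlam` FROM A RIGHT INVERSE OF `DΨ(0)` AS A FUNCTION** (the pointwise currency of the skeleton's binders `Rf`∕`hRf` — dag-n10-w1's `exists_rightInverse_fderiv_msChart_of_flat`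
delivers a real-linear `H` with `DΨ(0)(H y) = y` at every guarded near-flat background; this seat's `B16Ineq17NearFlatSubmersion.exists_rightInverse_fun_of_opNorm_sub_lt` delivers one from a flat
right inverse + (δ₂)): onto-ness is read off the right inverse, then §2. [cite: Balaban1985Variational, Sect. C (45)–(48) p.285, (82)–(83) p.290, (170)–(171) p.305; Balaban1989LargeFieldII, (1.12) p.359] -/
theorem exists_lam_msChart_of_rightInverse_fun (h𝔹 : ∀ j, k < j → 𝔹 j = ∅)
    (hU : AgreeOn 𝔹 (avgFamily (avOfRecord F N K) U) W) (hsb : SmallBelow (avOfRecord F N K) k U)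
    {R : (Fin (constrCard 𝔹 k) → lieSU (Fin N)) → PBond (F.P K) 0 → lieSU (Fin N)} (hR : ∀ v, fderiv ℝ (msChart F N K k 𝔹 W U) 0 (R v) = v)
    (hcrit : IsCritOnFibre F N K 𝔹 W U) :
    ∃ lam : (Fin (constrCard 𝔹 k) → lieSU (Fin N)) →L[ℝ] ℝ,
      fderiv ℝ (fun Y : PBond (F.P K) 0 → lieSU (Fin N) => wilsonAction4 (expChart U Y)) 0 = lam.comp (fderiv ℝ (msChart F N K k 𝔹 W U) 0) :=
  exists_lam_msChart_of_surjective h𝔹 hU hsb (fun v => ⟨R v, hR v⟩) hcrit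

/-- ★★ **THE QUANTITATIVE EDITION IN THE JUNCTION's SEMINORM CURRENCY — `hlam` WITH THE MULTIPLIER BOUND `|λ₀ v| ≤ j·ρ·q(v)`**: sizes by a seminorm `p` on the chart space and any size
`q` on the constraint space (dag-n12-c's word (ii): `p` = the `ℓ²(bonds)` norm at the record), a right inverse `R` of `DΨ(0)` as a function with `p(Rv) ≤ ρ·q(v)` (letters (ρ♭)+(δ₂) combined:
`ρ_act = ρ♭∕(1 − δ₂ρ♭)`), the CURRENT bound `|D(A∘expChart U₀)(0)x| ≤ j·p(x)` (this seat's `WilsonActionFirstVariationNearFlat` ∕ `B16Ineq17NearFlatWilsonLetters.letter_j_wilson`), and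
curve-criticality: then `D(A∘expChart U₀)(0) = λ₀ ∘ DΨ(0)` with `|λ₀ v| ≤ j·ρ·q(v)` — §2 + this seat's g2 `B16Ineq17NearFlatOneSidedSeminorm.abs_multiplier_apply_le_seminorm`; with a bound
`q(Ψ₂(w,w)) ≤ M₂·p(w)²` on the chart's curvature this is the letter (μ) `= j·ρ·M₂` of the skeleton (`B16Ineq17NearFlatOneSided.multiplier_letter_of_current`; `M₂` displayed).
[cite: Balaban1985Variational, (36)–(47) pp.283–285, (82)–(83) p.290, (170)–(171) p.305; Balaban1989LargeFieldII, (1.12) p.359, p.357] -/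
theorem exists_lam_msChart_bound_of_rightInverse_fun (h𝔹 : ∀ j, k < j → 𝔹 j = ∅)
    (hU : AgreeOn 𝔹 (avgFamily (avOfRecord F N K) U) W) (hsb : SmallBelow (avOfRecord F N K) k U)
    (p : Seminorm ℝ (PBond (F.P K) 0 → lieSU (Fin N))) (q : (Fin (constrCard 𝔹 k) → lieSU (Fin N)) → ℝ)
    {R : (Fin (constrCard 𝔹 k) → lieSU (Fin N)) → PBond (F.P K) 0 → lieSU (Fin N)} (hR : ∀ v, fderiv ℝ (msChart F N K k 𝔹 W U) 0 (R v) = v)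
    {j ρ : ℝ} (hj0 : 0 ≤ j) (hj : ∀ x, |fderiv ℝ (fun Y : PBond (F.P K) 0 → lieSU (Fin N) => wilsonAction4 (expChart U Y)) 0 x| ≤ j * p x)
    (hρ : ∀ v, p (R v) ≤ ρ * q v) (hcrit : IsCritOnFibre F N K 𝔹 W U) :
    ∃ lam : (Fin (constrCard 𝔹 k) → lieSU (Fin N)) →L[ℝ] ℝ,
      fderiv ℝ (fun Y : PBond (F.P K) 0 → lieSU (Fin N) => wilsonAction4 (expChart U Y)) 0 = lam.comp (fderiv ℝ (msChart F N K k 𝔹 W U) 0) ∧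
        ∀ v, |lam v| ≤ j * ρ * q v := by
  obtain ⟨lam, hlam⟩ := exists_lam_msChart_of_rightInverse_fun h𝔹 hU hsb hR hcrit
  exact ⟨lam, hlam, fun v => abs_multiplier_apply_le_seminorm p q _ _ hR hlam hj0 hj hρ v⟩

end Record

/-! ## §3  Regularity of the chart of record at `0`: the binders `hΨ₂` ∕ `hΨd` of the junction (and the first derivative) -/

section Regularity

/-- The chart of record is Fréchet-differentiable at `0` with derivative `DΨ(0) := fderiv ℝ Ψ 0` (from n07-w2's strict differentiability).
[cite: Balaban1985Variational, (82)–(83) p.290 (bookkeeping)] -/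
theorem hasFDerivAt_msChart (hU : AgreeOn 𝔹 (avgFamily (avOfRecord F N K) U) W) (hsb : SmallBelow (avOfRecord F N K) k U) :
    HasFDerivAt (msChart F N K k 𝔹 W U) (fderiv ℝ (msChart F N K k 𝔹 W U) 0) 0 :=
  (hasStrictFDerivAt_msChart hU hsb).hasFDerivAt

/-- The chart of record is differentiable at `0`. [cite: Balaban1985Variational, (82)–(83) p.290 (bookkeeping)] -/
theorem differentiableAt_msChart (hU : AgreeOn 𝔹 (avgFamily (avOfRecord F N K) U) W) (hsb : SmallBelow (avOfRecord F N K) k U) :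
    DifferentiableAt ℝ (msChart F N K k 𝔹 W U) 0 :=
  (hasFDerivAt_msChart hU hsb).differentiableAt

/-- ★ **THE BINDER `hΨ₂` AT THE CHART OF RECORD**: `Y ↦ DΨ(Y)` is Fréchet-differentiable at `0` with derivative `Ψ₂ := D²Ψ(0) = fderiv ℝ (fderiv ℝ Ψ) 0` — the chart is `C^∞` at `0`
(n07-w2's `contDiffAt_msChart`), in particular `C²`. [cite: Balaban1985Variational, (81)–(83) p.290 (second-order expansion at the background); Balaban1989LargeFieldII, (1.12) p.359] -/
theorem hasFDerivAt_fderiv_msChart (hU : AgreeOn 𝔹 (avgFamily (avOfRecord F N K) U) W) (hsb : SmallBelow (avOfRecord F N K) k U) :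
    HasFDerivAt (fun Y => fderiv ℝ (msChart F N K k 𝔹 W U) Y) (fderiv ℝ (fderiv ℝ (msChart F N K k 𝔹 W U)) 0) 0 := by
  have h2 : ContDiffAt ℝ 2 (msChart F N K k 𝔹 W U) 0 := (contDiffAt_msChart hU hsb).of_le le_top
  exact ((h2.fderiv_right (m := 1) (by norm_num)).differentiableAt (by norm_num)).hasFDerivAt

/-- ★ **THE BINDER `hΨd` AT THE CHART OF RECORD**: the chart is differentiable at every point near `0`. [cite: Balaban1985Variational, (81)–(83) p.290 (bookkeeping)] -/
theorem eventually_differentiableAt_msChart (hU : AgreeOn 𝔹 (avgFamily (avOfRecord F N K) U) W) (hsb : SmallBelow (avOfRecord F N K) k U) :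
    ∀ᶠ Y in 𝓝 (0 : PBond (F.P K) 0 → lieSU (Fin N)), DifferentiableAt ℝ (msChart F N K k 𝔹 W U) Y := by
  have h2 : ContDiffAt ℝ 2 (msChart F N K k 𝔹 W U) 0 := (contDiffAt_msChart hU hsb).of_le le_top
  exact (h2.eventually (by simp)).mono fun Y hY => hY.differentiableAt (by norm_num)

/-- The chart is `C²` at every point near `0` (so the binders persist along a family through `0`). [cite: Balaban1985Variational, (81)–(83) p.290 (bookkeeping)] -/
theorem eventually_contDiffAt_two_msChart (hU : AgreeOn 𝔹 (avgFamily (avOfRecord F N K) U) W) (hsb : SmallBelow (avOfRecord F N K) k U) :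
    ∀ᶠ Y in 𝓝 (0 : PBond (F.P K) 0 → lieSU (Fin N)), ContDiffAt ℝ 2 (msChart F N K k 𝔹 W U) Y := by
  have h2 : ContDiffAt ℝ 2 (msChart F N K k 𝔹 W U) 0 := (contDiffAt_msChart hU hsb).of_le le_top
  exact h2.eventually (by simp)

/-- **THE J-C REGULARITY PAIR IN ONE LINE**: `hΨ₂` with `Ψ₂ := D²Ψ(0)` and `hΨd`, at the chart of record. [cite: Balaban1985Variational, (81)–(83) p.290 (bookkeeping)] -/
theorem regularity_binders_msChart (hU : AgreeOn 𝔹 (avgFamily (avOfRecord F N K) U) W) (hsb : SmallBelow (avOfRecord F N K) k U) :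
    HasFDerivAt (fun Y => fderiv ℝ (msChart F N K k 𝔹 W U) Y) (fderiv ℝ (fderiv ℝ (msChart F N K k 𝔹 W U)) 0) 0 ∧
      ∀ᶠ Y in 𝓝 (0 : PBond (F.P K) 0 → lieSU (Fin N)), DifferentiableAt ℝ (msChart F N K k 𝔹 W U) Y :=
  ⟨hasFDerivAt_fderiv_msChart hU hsb, eventually_differentiableAt_msChart hU hsb⟩

end Regularity

/-! ## §4  From minimality: a minimiser over a class that is a neighbourhood of it is curve-critical, hence `hlam`; the class and determining set of record -/

section Minimal

/-- ★ **«MINIMAL ⇒ CRITICAL» OVER ANY CLASS THAT IS A NEIGHBOURHOOD OF THE MINIMISER** (generalising n07-e's `isCritOnFibre_of_isMinimizer_class17` ∕ `…_class6` ∕ `…_classTop` to an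
abstract class `reg` with `∀ᶠ V in 𝓝 U₀, V ∈ reg` — the shape dag-n12-w1's `B15Prop1ClassOpenAtRecord.eventually_mem_regMSCoPOfRecordAt` delivers for NODE 00's class of record): a curve through the
minimiser, differentiable at `0` as a curve of bond matrices, is continuous there, so stays in `reg` for small times, and Fermat applies on the fibre (`deriv_wilsonAction4_eq_zero_of_isMinimizer`).
[cite: Balaban1985Variational, (6) p.278, p.299 («minimal configuration»), p.300; Balaban1988Convergent, (2.12) p.256] -/
theorem isCritOnFibre_of_isMinimizer_of_eventually_mem {reg : Set (GaugeField (F.P K) 0 (SU N))}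
    (h : IsMinimizer (avOfRecord F N K) reg 𝔹 W U) (hreg : ∀ᶠ V in 𝓝 U, V ∈ reg) : IsCritOnFibre F N K 𝔹 W U := by
  intro γ h0 hd hc a ha
  have hγ : ContinuousAt (fun t (b : PBond (F.P K) 0) => γ t b) 0 := continuousAt_of_differentiableAt_val hd
  have hct : Tendsto (fun t (b : PBond (F.P K) 0) => γ t b) (𝓝 0) (𝓝 U) := by
    have ht : Tendsto (fun t (b : PBond (F.P K) 0) => γ t b) (𝓝 0) (𝓝 (fun b => γ 0 b)) := hγ.tendsto
    rw [h0] at ht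
    exact ht
  have hreg' : ∀ᶠ t in 𝓝 (0 : ℝ), γ t ∈ reg := hct.eventually hreg
  exact deriv_wilsonAction4_eq_zero_of_isMinimizer h h0 hreg' hc ha

/-- ★★ **`hlam` AT THE CHART OF RECORD FOR A MINIMISER OVER A CLASS THAT IS A NEIGHBOURHOOD OF IT** (onto-ness of `DΨ(0)` and the guard `hsb` displayed; the fibre condition is part of
`IsMinimizer`). [cite: Balaban1985Variational, (82)–(83) p.290, p.299–300; Balaban1989LargeFieldII, (1.12) p.359; Balaban1988Convergent, (2.12) p.256] -/
theorem exists_lam_msChart_of_isMinimizer_of_eventually_mem (h𝔹 : ∀ j, k < j → 𝔹 j = ∅) {reg : Set (GaugeField (F.P K) 0 (SU N))}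
    (h : IsMinimizer (avOfRecord F N K) reg 𝔹 W U) (hreg : ∀ᶠ V in 𝓝 U, V ∈ reg) (hsb : SmallBelow (avOfRecord F N K) k U)
    (hsurj : Function.Surjective (fderiv ℝ (msChart F N K k 𝔹 W U) 0)) :
    ∃ lam : (Fin (constrCard 𝔹 k) → lieSU (Fin N)) →L[ℝ] ℝ,
      fderiv ℝ (fun Y : PBond (F.P K) 0 → lieSU (Fin N) => wilsonAction4 (expChart U Y)) 0 = lam.comp (fderiv ℝ (msChart F N K k 𝔹 W U) 0) :=
  exists_lam_msChart_of_surjective h𝔹 h.2.1 hsb hsurj (isCritOnFibre_of_isMinimizer_of_eventually_mem h hreg)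

/-- ★★ **`hlam` AT THE CHART OF RECORD FOR A MINIMISER OVER THE (1.7)-CLASS** (def-R's `regMSOfRecord` reading of (2.12): `{U | ∀ n ≤ k′, |U(∂p) − 1| < r_n on omegaPlaqs Ω n}`, ANY
thresholds; n07-e's `isCritOnFibre_of_isMinimizer_class17`). [cite: Balaban1985Variational, (6) p.278, (82)–(83) p.290, p.299–300; Balaban1985RegularSpaces, (1.7) p.77; Balaban1988Convergent, (2.12) p.256] -/
theorem exists_lam_msChart_of_isMinimizer_class17 (h𝔹 : ∀ j, k < j → 𝔹 j = ∅) {k' : ℕ} {Ω : ℕ → Set (Site (F.P K) 0)} {r : ℕ → ℝ}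
    (h : IsMinimizer (avOfRecord F N K) {V | ∀ n, n ≤ k' → PlaqSmallOn (omegaPlaqs Ω n) (r n) V} 𝔹 W U)
    (hsb : SmallBelow (avOfRecord F N K) k U) (hsurj : Function.Surjective (fderiv ℝ (msChart F N K k 𝔹 W U) 0)) :
    ∃ lam : (Fin (constrCard 𝔹 k) → lieSU (Fin N)) →L[ℝ] ℝ,
      fderiv ℝ (fun Y : PBond (F.P K) 0 → lieSU (Fin N) => wilsonAction4 (expChart U Y)) 0 = lam.comp (fderiv ℝ (msChart F N K k 𝔹 W U) 0) :=
  exists_lam_msChart_of_surjective h𝔹 h.2.1 hsb hsurj (isCritOnFibre_of_isMinimizer_class17 h)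

/-- ★★ **«MINIMAL ⇒ CRITICAL» AT NODE 00's CLASS ON A SUPPORT `regMSCoPOfRecordAt F N ν K k′ Ω₀ Ω`** (print's (6) = (1.7) ∧ (1.9) on the top sequence of `Ω₀, Ω`, the class the N12∕s1
endpoint's solution map `bgMSCoPOfRecord` minimises over): the class is a neighbourhood of each member (dag-n12-w1's `eventually_mem_regMSCoPOfRecordAt`), so every minimiser of (2.12) over it
is curve-critical on its fibre — the hypothesis `hcrit` of §2 DISCHARGED at the record's class. [cite: Balaban1985Variational, (2),(6) p.278, p.299–300; Balaban1985RegularSpaces, (1.7),(1.9) p.77; Balaban1988Convergent, (2.12) p.256] -/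
theorem isCritOnFibre_of_isMinimizer_regMSCoPOfRecordAt (ν : Stage7Numerics) {k' : ℕ} (Ω₀ : Set (Site (F.P K) 0)) (Ω : ℕ → Set (Site (F.P K) 0))
    (h : IsMinimizer (avOfRecord F N K) (regMSCoPOfRecordAt F N ν K k' Ω₀ Ω) 𝔹 W U) : IsCritOnFibre F N K 𝔹 W U :=
  isCritOnFibre_of_isMinimizer_of_eventually_mem h (eventually_mem_regMSCoPOfRecordAt F N ν K k' Ω₀ Ω h.1)

/-- ★★ The same at THE CLASS OF RECORD `regMSCoPOfRecord F N ν K k′ Ω` (support of record). [cite: Balaban1985Variational, (2),(6) p.278, p.299–300; Balaban1988Convergent, p.255, (2.12) p.256] -/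
theorem isCritOnFibre_of_isMinimizer_regMSCoPOfRecord (ν : Stage7Numerics) {k' : ℕ} (Ω : ℕ → Set (Site (F.P K) 0))
    (h : IsMinimizer (avOfRecord F N K) (regMSCoPOfRecord F N ν K k' Ω) 𝔹 W U) : IsCritOnFibre F N K 𝔹 W U :=
  isCritOnFibre_of_isMinimizer_regMSCoPOfRecordAt ν _ Ω h

/-- ★★★ **`hlam` AT THE N12∕s1 ENDPOINT's OBJECTS** — class of record `regMSCoPOfRecord F N ν K k′ Ω`, determining set of record `𝐁_k(Z) = Bj M₁ Z k` ([III] (2.13); no member above `k`,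
`Bj_of_gt`), any datum `W` (the knit: `M˙(Q_k^{s*}Ṽ_k)`), and `U₀` a MINIMAL CONFIGURATION of (2.12) there (the `Y = 0` member of the (K′) family of dag-n12-c's J-C package ∕ dag-n12-w5's
`exists_realChartFamily_of_minimiserChart`): given the guard `hsb` and onto-ness of `DΨ(0)` (dag-n10-w1), `D(A∘expChart U₀)(0) = λ₀ ∘ DΨ(0)` at `Ψ := msChart F N K k (Bj M₁ Z k) W U₀` — the
J-C binder `hlam` with `hcrit` discharged by minimality. [cite: Balaban1985Variational, (82)–(83) p.290, (170)–(171) p.305, p.299–300; Balaban1989LargeFieldII, (1.12) p.359, p.357; Balaban1988Convergent, (2.12)–(2.13) pp.256–257] -/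
theorem exists_lam_msChart_Bj_of_isMinimizer_regMSCoPOfRecord (ν : Stage7Numerics) {k' : ℕ} (Ω : ℕ → Set (Site (F.P K) 0)) (M₁ : ℕ) (Z : Set (Site (F.P K) 0))
    {W : MSField (F.P K) (SU N)} {U₀ : GaugeField (F.P K) 0 (SU N)}
    (h : IsMinimizer (avOfRecord F N K) (regMSCoPOfRecord F N ν K k' Ω) (Bj M₁ Z k) W U₀)
    (hsb : SmallBelow (avOfRecord F N K) k U₀) (hsurj : Function.Surjective (fderiv ℝ (msChart F N K k (Bj M₁ Z k) W U₀) 0)) :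
    ∃ lam : (Fin (constrCard (Bj M₁ Z k) k) → lieSU (Fin N)) →L[ℝ] ℝ,
      fderiv ℝ (fun Y : PBond (F.P K) 0 → lieSU (Fin N) => wilsonAction4 (expChart U₀ Y)) 0 = lam.comp (fderiv ℝ (msChart F N K k (Bj M₁ Z k) W U₀) 0) :=
  exists_lam_msChart_of_surjective (fun _ hj => Bj_of_gt hj) h.2.1 hsb hsurj (isCritOnFibre_of_isMinimizer_regMSCoPOfRecord ν Ω h)

/-- ★★ **`hlam` AT `𝐁_k(Z)` FROM ONTO-NESS AND CURVE-CRITICALITY** (class-free edition at the determining set of record: `hU` fibre, `hsb` guard, `hsurj`, `hcrit`).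
[cite: Balaban1985Variational, (82)–(83) p.290; Balaban1989LargeFieldII, (1.12) p.359; Balaban1988Convergent, (2.12)–(2.13) pp.256–257] -/
theorem exists_lam_msChart_Bj_of_surjective (M₁ : ℕ) (Z : Set (Site (F.P K) 0)) {W : MSField (F.P K) (SU N)} {U₀ : GaugeField (F.P K) 0 (SU N)}
    (hU : AgreeOn (Bj M₁ Z k) (avgFamily (avOfRecord F N K) U₀) W) (hsb : SmallBelow (avOfRecord F N K) k U₀)
    (hsurj : Function.Surjective (fderiv ℝ (msChart F N K k (Bj M₁ Z k) W U₀) 0)) (hcrit : IsCritOnFibre F N K (Bj M₁ Z k) W U₀) :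
    ∃ lam : (Fin (constrCard (Bj M₁ Z k) k) → lieSU (Fin N)) →L[ℝ] ℝ,
      fderiv ℝ (fun Y : PBond (F.P K) 0 → lieSU (Fin N) => wilsonAction4 (expChart U₀ Y)) 0 = lam.comp (fderiv ℝ (msChart F N K k (Bj M₁ Z k) W U₀) 0) :=
  exists_lam_msChart_of_surjective (fun _ hj => Bj_of_gt hj) hU hsb hsurj hcrit

end Minimal

end Literature.MathematicalPhysics.QuantumFieldTheory.Balaban1983to89.Node00

end
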